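import Summits.BirchSwinnertonDyer.BirchSwinnertonDyer.Theorems.BiquadraticEisensteinDescentSymbolicMonskyDefs
import HarnessLib

set_option linter.dupNamespace false -- `Summit.BirchSwinnertonDyer.BirchSwinnertonDyer.Theorems.…` (summit = sub)
set_option autoImplicit false

/-!
# Route `BiquadraticEisensteinDescent` — DEFINITIONS (D-0017 `Theorems/<RouteSlug><Topic>Defs.lean`, reviewed):
# the PATTERN-FREE CRITERION of the symbolic Monsky engine (crux `HeegnerTwistCouplingInSupply`, stmt-BirchSwinnertonDyer-21381)

Cell `pub/bsd-wall`, width-prover seat `bsd-wall-cm-bed-w3` g20 (explicit-unit), route `BiquadraticEisensteinDescent`, crux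
stmt-BirchSwinnertonDyer-21381 `HeegnerTwistCouplingInSupply`; extends w3 g18's symbolic Monsky engine
(`…SymbolicMonskyDefs`: symbol data `SymbData k`, symbolic matrices `monskyOddS` / `monskyEvenS`, bitmask rows, the
verified-by-product invertibility check `detCheckOdd` / `detCheckEven`).

THE PROBLEM. In the sign-table game (card `sign-table-character-dichotomy`, census `…LinnikCensusKOne`) a recipe fixes the
residue classes of the auxiliary primes `q₁ … q_t` and their symbols against the BASE primes `p, r₁, …, r_k`, but NOT the mutual
symbols `(q_j/q_i)`: those are whatever the located primes happen to have. A recipe is PATTERN-FREE when Monsky's matrix is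
invertible for EVERY assignment of the mutual symbols — then its supply is `t` independent single-prime conditions (no bilinear
input), which is what makes the Linnik census possible (w3 g19, LINNIK-CENSUS-KERNEL-w3g19 §5–§6: pattern-free families exist for
all 16 / 176 / 2560 configurations at `k = 1 / 2 / 3`, checked by `decide` resp. by a solver over all `2^{t(t−1)/2}` patterns).

THE CRITERION (this file: definitions; soundness in `…HeegnerTwistCouplingInSupplySymbolicMonskyPatternFree.lean`). Fix an
auxiliary block `Q ⊆ {0, …, k−1}` of the index set of a symbol datum `d : SymbData k`. Changing the symbols `up i j` with BOTH
`i, j ∈ Q` changes Monsky's matrix `M` only in the `Q × Q` blocks, and in a very special way: (i) the rows outside `Q` do not change;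
(ii) the SUM of the `Q`-rows of each half does not change (the mutual symbols enter the pairs `(i, j), (j, i)` and the two diagonal
entries, which cancel in the sum up to the pattern-independent reciprocity bit); (iii) on vectors that are CONSTANT on `Q` in each
half, `M` does not change. Hence: if `M(d)` is invertible and every "difference functional" `z ↦ z_{q₀} + z_q` (`q₀, q ∈ Q`, either
half) is a linear combination of the pattern-independent functionals (i)–(ii), then `M(d')` is invertible for EVERY `d'` agreeing
with `d` off `Q × Q` (`SymbData.AgreeOffAux`). The second condition is certified exactly like `detCheckRows`: an UNVERIFIED `𝔽₂`
elimination oracle (`xbReduce` / `xbBasis` / `solveSel`) proposes a row selector, and only the verified facts "the selector is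
admissible (constant on the `Q`-rows of each half, `admissibleSel`)" and "the selected rows XOR to the target (`xorSelFrom`)" are
consumed (`diffCheckRows`); `SymbData.pfCheckOdd` / `pfCheckEven` = `detCheck… && diffCheckRows …`.

This replaces `2^{t(t−1)/2}` invertibility checks by ONE check and is the mechanism behind every pattern-free family found so far
(w3 g20 memo PATTERN-FREE-MECHANISM-w3g20: the number of auxiliary primes it needs is `s*/2 + 1`, `s*` the corank of Monsky's
matrix of the base twisted by the Heegner-forced virtual prime). §4 types the sign-table game at GENERAL `k` (bases
`E_{p r₁⋯r_k}` / `E_{2 p r₁⋯r_k}`; w3 g18's `dataK0` / `dataK1` are `k = 0, 1`): the base is itself a `SymbData (k + 1)`, an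
auxiliary cell is (class mod `8`, bitmask of its symbols against the base), `dataK` / `heegnerK` / `pfRecipeOdd` / `pfRecipeEven` /
`RealisesK` — the realisation predicate carries NO condition on the mutual symbols. DEFINITIONS ONLY (computable functions, two
`Prop`-valued structures with parameters, like `Matches` / `RealisesK1` of `…SymbolicMonskyDefs`); no theorem, no named fact, no
`sorry`, no instance, no notation. Nothing here asserts anything about Selmer groups, `L`-values, the crux or BSD.
References: [HeathBrown1994] D. R. Heath-Brown, Invent. Math. 118 (1994) 331–370, appendix by P. Monsky (typescript pp. 38–42);
[Feng1996] K. Feng, Acta Arith. 75 (1996) 71–83, §2 (rank of `M(G)` over `𝔽₂`).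
-/

namespace Summit.BirchSwinnertonDyer.BirchSwinnertonDyer.Theorems.SymbolicMonsky

/-! ## §1 The unverified `𝔽₂` span oracle (bitmask vectors paired with bookkeeping selector masks) -/

/-- Reduce a (vector, selector) pair by an XOR-basis whose members were inserted in order, each fully reduced by its
predecessors (so the leading bits `Nat.log2` are pairwise distinct and absent from later members). UNVERIFIED oracle step. -/
def xbReduce : List (ℕ × ℕ) → ℕ × ℕ → ℕ × ℕ
  | [], vm => vm
  | b :: bs, vm => xbReduce bs (if vm.1.testBit (Nat.log2 b.1) then (vm.1 ^^^ b.1, vm.2 ^^^ b.2) else vm)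

/-- Insert the (vector, selector) pairs one by one into an XOR-basis (reduce, keep if non-zero). UNVERIFIED oracle. -/
def xbBasis : List (ℕ × ℕ) → List (ℕ × ℕ) → List (ℕ × ℕ)
  | basis, [] => basis
  | basis, vm :: rest =>
    let r := xbReduce basis vm
    xbBasis (if r.1 = 0 then basis else basis ++ [r]) rest

/-- The oracle's proposed selector for the target `δ`: a bitmask over the generators such that (hopefully) the selected
generators XOR to `δ`. Only ever consumed through the verified checks below. -/
def solveSel (gens : List (ℕ × ℕ)) (δ : ℕ) : ℕ :=
  (xbReduce (xbBasis [] gens) (δ, 0)).2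

/-! ## §2 The pattern-independent functionals and the verified difference check -/

/-- The selector `c` (bit `l` selects row `l` of the `2k` bitmask rows; row `i < k` is half one, row `k + i` half two) is
ADMISSIBLE for the auxiliary block `Q`: it is constant on the `Q`-rows of each half, i.e. it selects a linear combination of
the rows outside `Q` and of the two `Q`-row sums. -/
def admissibleSel (k : ℕ) (Q : Fin k → Bool) (c : ℕ) : Bool :=
  (List.finRange k).all fun i => (List.finRange k).all fun j =>
    !(Q i && Q j) || (c.testBit i.val == c.testBit j.val && c.testBit (k + i.val) == c.testBit (k + j.val))

/-- Generators handed to the oracle: the rows outside `Q` (each with its unit selector) and the two `Q`-row sums (each with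
the selector of all `Q`-rows of its half). `R` = the `2k` bitmask rows. -/
def pfGens (k : ℕ) (Q : Fin k → Bool) (R : List ℕ) : List (ℕ × ℕ) :=
  let out := (List.finRange k).filter fun i => !Q i
  let inn := (List.finRange k).filter Q
  let qsel₁ := (inn.map fun i => 2 ^ i.val).foldr (· ^^^ ·) 0
  let qsel₂ := (inn.map fun i => 2 ^ (k + i.val)).foldr (· ^^^ ·) 0
  (out.map fun i => (R.getD i.val 0, 2 ^ i.val)) ++ (out.map fun i => (R.getD (k + i.val) 0, 2 ^ (k + i.val))) ++
    [(xorSelFrom qsel₁ 0 R, qsel₁), (xorSelFrom qsel₂ 0 R, qsel₂)]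

/-- Verified check for ONE target functional `δ` (bitmask over the `2k` coordinates): the oracle's selector is admissible
and the selected rows XOR to `δ`. -/
def diffCheckOne (k : ℕ) (Q : Fin k → Bool) (R : List ℕ) (δ : ℕ) : Bool :=
  let c := solveSel (pfGens k Q R) δ
  admissibleSel k Q c && (xorSelFrom c 0 R == δ)

/-- Verified DIFFERENCE CHECK: with `q₀` the first index of `Q`, every difference functional `z ↦ z_{q₀} + z_q` (`q ∈ Q`,
half one: bits `q₀, q`; half two: bits `k + q₀, k + q`) passes `diffCheckOne`. Vacuous when `Q` has at most one element. -/
def diffCheckRows (k : ℕ) (Q : Fin k → Bool) (R : List ℕ) : Bool :=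
  match (List.finRange k).filter Q with
  | [] => true
  | q₀ :: qs => qs.all fun q =>
      diffCheckOne k Q R (2 ^ q₀.val ^^^ 2 ^ q.val) && diffCheckOne k Q R (2 ^ (k + q₀.val) ^^^ 2 ^ (k + q.val))

/-! ## §3 The criterion on symbol data -/

namespace SymbData

variable {k : ℕ}

/-- The symbol data `d'` AGREES with `d` OFF the auxiliary block `Q`: same classes mod `8`, and the same symbol bits
`up i j` except possibly when both `i` and `j` lie in `Q` (the mutual symbols of the auxiliary primes). -/
structure AgreeOffAux (Q : Fin k → Bool) (d d' : SymbData k) : Prop where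
  /-- same residue classes mod `8` -/
  cls_eq : ∀ i, d'.cls i = d.cls i
  /-- same symbols outside `Q × Q` -/
  up_eq : ∀ i j, Q i = false ∨ Q j = false → d'.up i j = d.up i j

/-- PATTERN-FREE CHECK, odd matrix: `det M_odd(d) = 1` (verified product check) and the verified difference check on the
bitmask rows of `M_odd(d)`. Sound: every `d'` agreeing with `d` off `Q × Q` has `det M_odd(d') = 1`
(`…SymbolicMonskyPatternFree.lean`). -/
def pfCheckOdd (d : SymbData k) (Q : Fin k → Bool) : Bool :=
  d.detCheckOdd && diffCheckRows k Q d.rowsOdd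

/-- PATTERN-FREE CHECK, even matrix (same with `M_even`). -/
def pfCheckEven (d : SymbData k) (Q : Fin k → Bool) : Bool :=
  d.detCheckEven && diffCheckRows k Q d.rowsEven

end SymbData

/-! ## §4 The sign-table game at GENERAL `k`: base data, auxiliary cells, symbol data, Heegner check, realisation

The bases `E_{p r₁ ⋯ r_k}` / `E_{2 p r₁ ⋯ r_k}` (`k ≥ 0` odd primes `r_i`; `k = 0, 1` are w3 g18's `dataK0` / `dataK1`). The BASE is
itself a symbol datum `base : SymbData (k + 1)` (index `0` = `p`, index `b` = `r_b`); an AUXILIARY CELL is a residue class mod `8`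
together with the symbol vector of the auxiliary prime against the `k + 1` base primes, as a bitmask (bit `b` = `[(q/P_b) = −1]`;
bit `0` is the sign `[(q/p) = −1]` of the one-parameter game). -/

/-- An auxiliary cell at general `k`: (class mod `8`, bitmask of `[(q/P_b) = −1]` over the base indices `b = 0, …, k`). -/
abbrev AuxCell : Type := Fin 4 × ℕ

/-- Symbol data of `(P₀, …, P_k, q₁, …, q_t)` from the base datum, the auxiliary cells and a MUTUAL PATTERN
`pat i j = [(q_{j+1}/q_{i+1}) = −1]` (`i < j`, `0`-based; values for `i ≥ j` ignored). Base indices first, then the auxiliary ones. -/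
def dataK {k : ℕ} (base : SymbData (k + 1)) (aux : List AuxCell) (pat : ℕ → ℕ → Bool) :
    SymbData (k + 1 + aux.length) where
  cls i := if h : i.val < k + 1 then base.cls ⟨i.val, h⟩ else (aux.getD (i.val - (k + 1)) (0, 0)).1
  up i j :=
    if hj : j.val < k + 1 then (if hi : i.val < k + 1 then base.up ⟨i.val, hi⟩ ⟨j.val, hj⟩ else false)
    else if i.val < k + 1 then (aux.getD (j.val - (k + 1)) (0, 0)).2.testBit i.val
    else pat (i.val - (k + 1)) (j.val - (k + 1))

/-- The auxiliary block of `dataK`: the indices `≥ k + 1`. -/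
def auxQ (k t : ℕ) : Fin (k + 1 + t) → Bool := fun i => decide (k + 1 ≤ i.val)

/-- The HEEGNER check at general `k` (for `K′ = ℚ(√−q₁⋯q_t)` and the level `32 n₀²` / `16 n₀²`, `n₀ = (2) P₀ ⋯ P_k`): `t ≥ 1`,
`q₁⋯q_t ≡ 7 (mod 8)` (so `2` splits), and for every base prime `P_b`: `(−q₁⋯q_t / P_b) = +1`, i.e. the number of auxiliary
primes with `(q/P_b) = −1` has the parity of `[(−1/P_b) = −1]`. -/
def heegnerK {k : ℕ} (base : SymbData (k + 1)) (aux : List AuxCell) : Bool :=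
  decide (0 < aux.length) && ((aux.map fun c => clsVal c.1).prod % 8 == 7) &&
    (List.finRange (k + 1)).all fun b => xorFold aux (fun c => c.2.testBit b.val) == negNegOne (base.cls b)

/-- PATTERN-FREE RECIPE CHECK, odd base `E_{P₀⋯P_k}`: Heegner check and the pattern-free check of `dataK` at the reference
pattern "all mutual symbols `+1`" on the auxiliary block. One `decide` per (base, cells); no mutual symbol enters. -/
def pfRecipeOdd {k : ℕ} (base : SymbData (k + 1)) (aux : List AuxCell) : Bool :=
  heegnerK base aux && (dataK base aux fun _ _ => false).pfCheckOdd (auxQ k aux.length)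

/-- PATTERN-FREE RECIPE CHECK, even base `E_{2P₀⋯P_k}`. -/
def pfRecipeEven {k : ℕ} (base : SymbData (k + 1)) (aux : List AuxCell) : Bool :=
  heegnerK base aux && (dataK base aux fun _ _ => false).pfCheckEven (auxQ k aux.length)

/-- The primes `P : Fin (k+1) → ℕ` (base) and `q : Fin t → ℕ` (auxiliary) REALISE the base datum and the auxiliary cells:
`P` realises `base` (`Matches`), the `q_i` are distinct primes outside the base, in the classes of their cells, with the
prescribed symbols `(q_i/P_b)`. NO condition on the mutual symbols `(q_j/q_i)`. -/
structure RealisesK {k : ℕ} (base : SymbData (k + 1)) (aux : List AuxCell) (P : Fin (k + 1) → ℕ)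
    (q : Fin aux.length → ℕ) : Prop where
  /-- the base primes realise the base datum -/
  base_matches : Matches P base
  /-- the `q_i` are prime -/
  qprime : ∀ i, (q i).Prime
  /-- `q_i` lies in the class of its cell -/
  q_mod : ∀ i, q i % 8 = clsVal (aux.getD i.val (0, 0)).1
  /-- `q_i` is not a base prime -/
  q_ne : ∀ i b, q i ≠ P b
  /-- the `q_i` are pairwise distinct -/
  qinj : Function.Injective q
  /-- the symbols `(q_i/P_b)` are the cell's -/
  symb_iff : ∀ i b, jacobiSym (q i) (P b) = -1 ↔ (aux.getD i.val (0, 0)).2.testBit b.val = true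

end Summit.BirchSwinnertonDyer.BirchSwinnertonDyer.Theorems.SymbolicMonsky
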